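/-
Origin: expansion seat `prover-pub-hodgecm-mc-binder-1-g15-0`, handover #R94 2026-08-20T18:37:14Z md5 5ed7cb297af1 (215 l.; NEW additive universe-free leaf; imports #R93 + Vendored UnitaryBallClassMap only; drops ⇒ {#R97}; NAME LIST: HodgeCM.Model.ClassLiftTwist.mfderiv_anMap_comp_unifDeriv · HodgeCM.Model.ClassLiftTwist.formPullback₁_pullback_anMap_mulVec · HodgeCM.Model.ClassLiftTwist.classLift_pull_mulVec · HodgeCM.Model.ClassLiftTwist.classLift_pull_mulVec') (`HOME/mc/pub-hodgecm-mc-binder-1-g15/stage59/HodgeCM/Model/ClassLiftTwist.lean`, md5 5ed7cb297af1, 215 lines);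
landed by the gen-24 packager (p-g24) in gate run 59 as `HodgeCM/Model/ClassLiftTwist.lean` (verbatim).
-/
/-
Copyright (c) 2026 the pub-hodgecm formalisation cell (harness21).  New file, not vendored.
Origin: session prover-pub-hodgecm-mc-binder-1-g15-0 (unit pub-hodgecm-mc-binder-1-g15, BINDER PROVER gen 15 of lineage mc-binder-1;
content lane (J-Liu-Θ), scope memo `HOME/mc/pub-hodgecm-mc-binder-1-g14/JLIU-THETA-SCOPE.md` §9 (J2), HECKE-TOWER sub-leaf (α2)-twist:
«the holomorphic lift of a pulled-back class along a Hecke-translated level map is the translate `h^*(lift ω)`»), 2026-08-20.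
Intended final place: `HodgeCM/Model/ClassLiftTwist.lean` (NEW additive leaf, universe-free; imports ONLY `HodgeCM.Model.LevelCoveringTwist`
(this seat, same kit) and the vendored twin `…ShimuraVarieties.UnitaryBallClassMap`; nothing imports it; drops with `LevelCoveringTwist`).
-/
import Summits.HodgeConjecture.HodgeCM.Model.LevelCoveringTwist
import Literature.AlgebraicGeometry.ShimuraVarieties.UnitaryBallClassMap

set_option autoImplicit false

/-!
# The holomorphic lift along a Hecke-translated level map: `lift (f^* ω) = h^* (lift ω)`

The TWISTED companion of the vendored `UnitaryBallUniformisationDatum.classLift_pull` (`UnitaryBallHolomorphicLift`, (saturate)).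
Let `f : X' ⟶ X` be a morphism of compact ball quotient surfaces with data `D'`, `D` (same hermitian space up to the frames:
`𝔣'.t = 𝔣.t`) lying over the TRANSLATE by an isometry `g ∈ U(H^{τ₁}) = D.realPoints`: `f(ℂ) (unif' v) = unif (g v)` on the cone —
the morphism produced by `LevelCoveringTwist.exists_hom_map_unif_eq_mulVec` for `g Γ' g⁻¹ ≤ Γ`, i.e. the second projection `π_g`
of a Hecke correspondence read between the algebraic models.  Write `h := frameIso 𝔣 g ∈ U(2,1)` for `g` in the ball frame.  Then:

* `anMap_modelUnif_mulVec` — `f^an ∘ ψ' = ψ ∘ (h •)` on the ball (`ψ`, `ψ'` the uniformizations read in Hodge models);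
* `mfderiv_anMap_comp_unifDeriv` — the chain rule `d(f^an)_{ψ' z} ∘ dψ'_z = dψ_{h z} ∘ J(h, z)`;
* `formPullback₁_pullback_anMap_mulVec` — for a `ℂ`-linear one-form `α` on `X^an`:
  `formPullback₁' ((f^an)^* α) = h^*(formPullback₁ α) : z ↦ (Jac h z)ᵀ · (formPullback₁ α)(h z)`;
* `classLift_pull_mulVec` — **for `ω ∈ F¹H¹(X)`: `lift' (f^* ω) = h^* (lift ω)`**, i.e.
  `D'.classLift 𝔣' (f^* ω) = fun z ↦ (Jac h z)ᵀ *ᵥ D.classLift 𝔣 ω (h • z)` — the holomorphic representative of `f^* ω` is `(f^an)^* α`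
  (GAGA functoriality + uniqueness of holomorphic representatives, exactly as in `classLift_pull`), and the previous item;
  `classLift_pull_mulVec'` — the same in the `factorPullback cotangentCocycle` vocabulary of `UnitaryBallClassMap` / `BallFormsTransfer`.

With `g = 1` (`h = 1`, `Jac 1 z = 1`) these are `anMap_modelUnif`, `unifDeriv_eq_mfderiv_anMap_comp`, `formPullback₁_pullback_anMap`,
`classLift_pull`.  Together with `LevelCoveringTwist` (π_g algebraic), `LevelCovering`/`classLift_pull` (π algebraic, `lift (π^* ω) = lift ω`)
and `BallFormsTransfer` (`Tr = Σ (γ⁻¹)^*` on holomorphic forms) this is the form-side of the (J2) identity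
`lift (T_g ω) = [Γ':N]⁻¹ Σ_q (g γ̃_q)^* lift ω`; the remaining cohomological input (comparison of the algebraic level cover `X_N` with the
topological `LevelCover N` carrying the vendored `heckeCorrespondenceAction`, and `T_g F¹ ⊆ F¹`) is the HECKE-TOWER node's.
KIND: kernel theorems over vendored tree modules; nothing cited anew, nothing minted; 0 proof holes; expected `#print axioms` ⊆
{propext, Classical.choice, Quot.sound}.

References: A. Borel, *Automorphic forms on SL₂(ℝ)* (1997), §5.13–5.14; J.-P. Serre, GAGA (1956), §2 n°5; C. Voisin, *Hodge Theory and
Complex Algebraic Geometry I* (2002), §2.2.1, §7.1.1 Cor. 7.6, §7.3.2; G. Shimura (1971), §7.3, §8.3 (the action of a correspondence on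
holomorphic differentials through its two projections).
-/

noncomputable section

open Matrix MulAction Function Set Filter
open scoped Manifold ContDiff Topology TensorProduct
open CategoryTheory
open Literature.Geometry.ComplexHyperbolic
open Literature.Geometry.ComplexHyperbolic.BallModel (U21 Ball Jac actVec)
open Literature.Geometry.Kaehler (MForm IsHolomorphicInCharts holFormsInCharts isOfType_of_mem isHolomorphicInCharts_of_mem isSmoothForm_of_mem)
open Literature.NumberTheory.Transcendental
open Literature.AlgebraicGeometry.HodgeTheory
open Literature.AlgebraicGeometry.Motives (SchemeOver ComplexPoints AlgPoints bettiCohomology ofRatClassBaseChange IsSmoothProjective)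

namespace HodgeCM.Model.ClassLiftTwist

open Literature.AlgebraicGeometry.ShimuraVarieties UnitaryBallUniformisationDatum
open HodgeCM.Model.LevelCoveringTwist (unif_mulVec_coneLift)

variable {X X' : SchemeOver ℂ} (D : UnitaryBallUniformisationDatum 2 X) (D' : UnitaryBallUniformisationDatum 2 X')
  (A : HodgeModel 2 X) (A' : HodgeModel 2 X') (f : X' ⟶ X) (𝔣 : D.SylvesterFrame) (𝔣' : D'.SylvesterFrame) (g : D.realPoints)

/-! ### The ball calculus of a translated level map (any Hodge models) -/

/-- **`f^an ∘ ψ' = ψ ∘ (h •)` on the ball** when `f(ℂ) ∘ unif' = unif ∘ g` on the cone and the frames agree (`h = frameIso 𝔣 g`).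
[cite: SerreGAGA1956, §2 n°5 (fonctorialité)] [cite: Shimura1973, §7.3] -/
theorem anMap_modelUnif_mulVec (hT : 𝔣'.t = 𝔣.t)
    (hf : ∀ v ∈ D'.cone, AlgPoints.map f (D'.unif v) = D.unif (((g : GL (Fin 3) ℂ) : Matrix (Fin 3) (Fin 3) ℂ) *ᵥ v)) (z : Ball) :
    HodgeModel.anMap A A' f (D'.modelUnif A' 𝔣' z.1) = D.modelUnif A 𝔣 (D.frameIso 𝔣 g • z).1 := by
  have hc : 𝔣'.t *ᵥ ![z.1 0, z.1 1, 1] ∈ D'.cone := (D'.coneLift 𝔣' z).2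
  change A.isAnalytification.homeomorph.symm (AlgPoints.map f (A'.toComplexPoints (D'.modelUnif A' 𝔣' z.1))) = _
  rw [toComplexPoints_modelUnif]
  change A.isAnalytification.homeomorph.symm (AlgPoints.map f (D'.unif (𝔣'.t *ᵥ ![z.1 0, z.1 1, 1]))) = _
  rw [hf _ hc, hT, show 𝔣.t *ᵥ ![z.1 0, z.1 1, 1] = (D.coneLift 𝔣 z : Fin 3 → ℂ) from rfl, unif_mulVec_coneLift 𝔣 g z]
  rfl

/-- Near a ball point, `f^an ∘ ψ' = ψ ∘ actVec h` (the ball is open). [folklore] -/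
theorem anMap_comp_modelUnif_eventuallyEq (hT : 𝔣'.t = 𝔣.t)
    (hf : ∀ v ∈ D'.cone, AlgPoints.map f (D'.unif v) = D.unif (((g : GL (Fin 3) ℂ) : Matrix (Fin 3) (Fin 3) ℂ) *ᵥ v)) (z : Ball) :
    (HodgeModel.anMap A A' f ∘ D'.modelUnif A' 𝔣') =ᶠ[𝓝 z.1] (D.modelUnif A 𝔣 ∘ actVec (D.frameIso 𝔣 g)) := by
  filter_upwards [BallForms.isOpen_ballSet.mem_nhds (BallForms.coe_mem_ballSet z)] with w hw
  have h := anMap_modelUnif_mulVec D D' A A' f 𝔣 𝔣' g hT hf ⟨w, hw⟩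
  rw [← BallModel.actVec_eq] at h
  exact h

/-- **Chain rule `d(f^an)_{ψ' z} ∘ dψ'_z = dψ_{h z} ∘ J(h, z)`** (`f^an` holomorphic by GAGA, `ψ`, `ψ'` holomorphic on the ball, `actVec h`
with derivative `Jac h z`). [cite: VoisinHodgeI2002, §2.2.1] [cite: SerreGAGA1956, §2 n°5 (fonctorialité)] -/
theorem mfderiv_anMap_comp_unifDeriv (hX : IsSmoothProjective 2 X) (hX' : IsSmoothProjective 2 X') (hT : 𝔣'.t = 𝔣.t)
    (hf : ∀ v ∈ D'.cone, AlgPoints.map f (D'.unif v) = D.unif (((g : GL (Fin 3) ℂ) : Matrix (Fin 3) (Fin 3) ℂ) *ᵥ v)) (z : Ball) :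
    (mfderiv 𝓘(ℝ, A'.model) 𝓘(ℝ, A.model) (HodgeModel.anMap A A' f) (D'.modelUnif A' 𝔣' z.1)).comp (D'.unifDeriv A' 𝔣' z.1) =
      (D.unifDeriv A 𝔣 (D.frameIso 𝔣 g • z).1).comp (jacCLM (D.frameIso 𝔣 g) z) := by
  -- derivative of `f^an ∘ ψ'` at `z`
  have hφ : MDifferentiableAt 𝓘(ℝ, A'.model) 𝓘(ℝ, A.model) (HodgeModel.anMap A A' f) (D'.modelUnif A' 𝔣' z.1) :=
    (HodgeModel.mdifferentiable_anMap A A' f hX' hX _).real_of_complex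
  have h1 : HasMFDerivAt 𝓘(ℝ, Fin 2 → ℂ) 𝓘(ℝ, A.model) (HodgeModel.anMap A A' f ∘ D'.modelUnif A' 𝔣') z.1
      ((mfderiv 𝓘(ℝ, A'.model) 𝓘(ℝ, A.model) (HodgeModel.anMap A A' f) (D'.modelUnif A' 𝔣' z.1)).comp (D'.unifDeriv A' 𝔣' z.1)) :=
    hφ.hasMFDerivAt.comp z.1 (D'.mdifferentiableAt_modelUnif A' 𝔣' z).real_of_complex.hasMFDerivAt
  -- derivative of `ψ ∘ actVec h` at `z`
  have hψ : HasMFDerivAt 𝓘(ℝ, Fin 2 → ℂ) 𝓘(ℝ, A.model) (D.modelUnif A 𝔣) (actVec (D.frameIso 𝔣 g) z.1)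
      (D.unifDeriv A 𝔣 (D.frameIso 𝔣 g • z).1) := by
    rw [BallModel.actVec_eq]
    exact (D.mdifferentiableAt_modelUnif A 𝔣 _).real_of_complex.hasMFDerivAt
  have h2 : HasMFDerivAt 𝓘(ℝ, Fin 2 → ℂ) 𝓘(ℝ, A.model) (D.modelUnif A 𝔣 ∘ actVec (D.frameIso 𝔣 g)) z.1
      ((D.unifDeriv A 𝔣 (D.frameIso 𝔣 g • z).1).comp (jacCLM (D.frameIso 𝔣 g) z)) :=
    hψ.comp z.1 (hasMFDerivAt_actVec (D.frameIso 𝔣 g) z)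
  -- the two maps agree near `z`
  have h2' := h2.congr_of_eventuallyEq (anMap_comp_modelUnif_eventuallyEq D D' A A' f 𝔣 𝔣' g hT hf z)
  exact h1.mfderiv.symm.trans h2'.mfderiv

variable {A} in
/-- **`(f^an)^* α` pulls back to the ball (through `ψ'`) as the translate `h^*` of the pull-back of `α` (through `ψ`)**, for a `ℂ`-linear
one-form `α`: `formPullback₁' ((f^an)^* α) z = (Jac h z)ᵀ · formPullback₁ α (h z)`. [cite: VoisinHodgeI2002, §2.2.1] [cite: Borel1997, §5.14] -/
theorem formPullback₁_pullback_anMap_mulVec (hX : IsSmoothProjective 2 X) (hX' : IsSmoothProjective 2 X') (hT : 𝔣'.t = 𝔣.t)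
    (hf : ∀ v ∈ D'.cone, AlgPoints.map f (D'.unif v) = D.unif (((g : GL (Fin 3) ℂ) : Matrix (Fin 3) (Fin 3) ℂ) *ᵥ v))
    {α : MForm 𝓘(ℝ, A.model) A.carrier ℂ 1} (hα : IsComplexLinearForm α) :
    D'.formPullback₁ A' 𝔣' (α.pullback 𝓘(ℝ, A'.model) (HodgeModel.anMap A A' f)) =
      fun z ↦ (Jac (D.frameIso 𝔣 g) z)ᵀ *ᵥ D.formPullback₁ A 𝔣 α (D.frameIso 𝔣 g • z) := by
  have key : ∀ {x y : A.carrier}, x = y → ∀ u : A.model, α x (fun _ ↦ u) = α y (fun _ ↦ u) := by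
    intro x y h u
    subst h
    rfl
  funext z i
  have hpt := anMap_modelUnif_mulVec D D' A A' f 𝔣 𝔣' g hT hf z
  have hder := mfderiv_anMap_comp_unifDeriv D D' A A' f 𝔣 𝔣' g hX hX' hT hf z
  -- `((f^an)^* α)_{ψ' z} (dψ'_z eᵢ) = α_{f^an (ψ' z)} (d(f^an) (dψ'_z eᵢ)) = α_{ψ (h z)} (dψ_{h z} (J(h,z) eᵢ))`
  have hL : D'.formPullback₁ A' 𝔣' (α.pullback 𝓘(ℝ, A'.model) (HodgeModel.anMap A A' f)) z i =
      α (D.modelUnif A 𝔣 (D.frameIso 𝔣 g • z).1)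
        (fun _ ↦ ((D.unifDeriv A 𝔣 (D.frameIso 𝔣 g • z).1).comp (jacCLM (D.frameIso 𝔣 g) z)) (Pi.single i 1)) := by
    rw [formPullback₁_apply, ← hder]
    exact key hpt _
  rw [hL]
  simp only [ContinuousLinearMap.comp_apply, jacCLM_apply, jac_mulVec_single, map_add, unifDeriv_smul]
  rw [mform₁_apply_add, mform₁_apply_smul hα, mform₁_apply_smul hα]
  simp [Matrix.mulVec, dotProduct, Fin.sum_univ_two, formPullback₁_apply]

/-! ### The holomorphic lift of a pulled-back class -/

variable {D f 𝔣} in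
/-- **(saturate, twisted) `lift' (f^* ω) = h^* (lift ω)` for `ω ∈ F¹H¹(X)`** and a morphism `f : X' ⟶ X` over the translate by `g`
(`f(ℂ) ∘ unif' = unif ∘ g` on the cone, frames agree, `h = frameIso 𝔣 g`): the holomorphic representative of `f^* ω` is `(f^an)^* α`
(GAGA: `f^an` is holomorphic, so `(f^an)^* α` is a closed `(1,0)`-form with class `Θ'(f^* ω)` by naturality of the standard de Rham family and of
`Θ`; uniqueness of holomorphic representatives, Voisin I Cor. 7.6) — verbatim the argument of `classLift_pull` — and `(f^an)^* α` pulls back to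
the ball as `h^*` of the pull-back of `α` (`formPullback₁_pullback_anMap_mulVec`). [cite: SerreGAGA1956, §2 n°5 (fonctorialité)]
[cite: VoisinHodgeI2002, §7.1.1 Cor. 7.6 and §7.3.2] [cite: Borel1997, §5.14] -/
theorem classLift_pull_mulVec (hHD : exists_isReal_hodgeModel) (hI : hodgePQ_independent_of_hodgeModel) (hT : 𝔣'.t = 𝔣.t)
    (hf : ∀ v ∈ D'.cone, AlgPoints.map f (D'.unif v) = D.unif (((g : GL (Fin 3) ℂ) : Matrix (Fin 3) (Fin 3) ℂ) *ᵥ v))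
    {hX : IsSmoothProjective 2 X} {c : ℂ ⊗[ℚ] bettiCohomology X 1} (hc : c ∈ (BettiUniverse.hodge hHD hX 1).F 1) :
    D'.classLift hHD 𝔣' ((BettiUniverse.pull f 1).baseChange ℂ c) =
      fun z ↦ (Jac (D.frameIso 𝔣 g) z)ᵀ *ᵥ D.classLift hHD 𝔣 c (D.frameIso 𝔣 g • z) := by
  set hXD := D.isSmoothProjective
  set hXD' := D'.isSmoothProjective
  set B := stdModel hHD hXD with hB
  set B' := stdModel hHD hXD' with hB'
  haveI : CompleteSpace (Fin 2 → ℂ) := FiniteDimensional.complete ℂ (Fin 2 → ℂ)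
  have hcl : B.HolFormsClosed 1 := B.holFormsClosed_of_finrank_succ hXD
  have hcl' : B'.HolFormsClosed 1 := B'.holFormsClosed_of_finrank_succ hXD'
  have hcp : c ∈ B.ratPiece hXD 1 1 0 := mem_ratPiece_stdModel_of_mem_hodge_F hHD hI hXD hc
  set α := B.oneFormOfClassSurface hXD c with hαdef
  -- the analytified morphism and the pulled-back form
  set φ : B'.carrier → B.carrier := HodgeModel.anMap B B' f with hφdef
  have hφ' : MDifferentiable 𝓘(ℂ, Fin 2 → ℂ) 𝓘(ℂ, Fin 2 → ℂ) φ :=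
    HodgeModel.mdifferentiable_anMap B B' f hXD' hXD
  have hφ : ContMDiff 𝓘(ℝ, Fin 2 → ℂ) 𝓘(ℝ, Fin 2 → ℂ) ∞ φ := hφ'.contMDiff_real_of_complex
  set β : MForm 𝓘(ℝ, Fin 2 → ℂ) B'.carrier ℂ 1 :=
    (α : MForm 𝓘(ℝ, Fin 2 → ℂ) B.carrier ℂ 1).pullback 𝓘(ℝ, Fin 2 → ℂ) φ with hβdef
  have hβc : β ∈ cclosedSmoothForms (Fin 2 → ℂ) B'.carrier 1 :=
    pullback_mem_cclosedSmoothForms hφ (hcl α)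
  have hβt : IsOfType 1 0 β := (isOfType_of_mem α).pullback hφ'
  have hβh : β ∈ holFormsInCharts (Fin 2 → ℂ) B'.carrier 1 :=
    mem_holFormsInCharts_of_isClosedForm_of_isOfType_one_zero
      ((mem_cclosedSmoothForms_iff β).1 hβc).1 ((mem_cclosedSmoothForms_iff β).1 hβc).2 hβt
  -- its class is `Θ'(f^* c)`
  have hclassβ : B'.holFormClass 1 hcl' ⟨β, hβh⟩ =
      B'.complexification hXD' 1 ((BettiUniverse.pull f 1).baseChange ℂ c) := by
    rw [HodgeModel.holFormClass_apply]
    have hmk : complexDeRhamCohomology.mk (Fin 2 → ℂ) B'.carrier 1 (B'.holFormsToClosed 1 hcl' ⟨β, hβh⟩) =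
        complexDeRhamCohomology.map (Fin 2 → ℂ) hφ 1
          (complexDeRhamCohomology.mk (Fin 2 → ℂ) B.carrier 1 ⟨α, hcl α⟩) := by
      rw [complexDeRhamCohomology.map_mk]
      rfl
    rw [hmk, B'.deRham_isNatural B'.carrier B.carrier φ hφ 1]
    have hΘ : B'.deRham B.carrier 1 (complexDeRhamCohomology.mk (Fin 2 → ℂ) B.carrier 1 ⟨α, hcl α⟩) =
        B.complexification hXD 1 c := by
      rw [← B.holFormClass_oneFormOfClassSurface_of_mem_ratPiece hXD hcp, HodgeModel.holFormClass_apply]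
      rfl
    rw [hΘ, HodgeModel.complexification_apply, HodgeModel.complexification_apply]
    have hnat := HodgeModel.map_anMap_pullback B B' f 1
      (ofRatClassBaseChange (ComplexPoints X) 1 c)
    rw [map_ofRatClassBaseChange _ 1 (AlgPoints.mapContinuous (L := ℂ) f)] at hnat
    exact hnat
  -- hence it IS the holomorphic representative of `f^* c`
  have hβeq : (⟨β, hβh⟩ : holFormsInCharts (Fin 2 → ℂ) B'.carrier 1) =
      B'.oneFormOfClassSurface hXD' ((BettiUniverse.pull f 1).baseChange ℂ c) :=
    B'.eq_oneFormOfClass_of_holFormClass_eq hXD' hcl' hclassβ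
  -- and the lifts agree pointwise, up to the translate `h^*`
  rw [classLift_apply, classLift_apply, ← hβeq]
  exact formPullback₁_pullback_anMap_mulVec D D' B' f 𝔣 𝔣' g hXD hXD' hT hf (isOfType_of_mem α).isComplexLinearForm

variable {D f 𝔣} in
/-- The same in the automorphy-factor vocabulary of `UnitaryBallClassMap` / `BallFormsTransfer`:
`lift' (f^* ω) = factorPullback cotangentCocycle h (lift ω)`. [cite: Borel1997, §5.13–5.14] -/
theorem classLift_pull_mulVec' (hHD : exists_isReal_hodgeModel) (hI : hodgePQ_independent_of_hodgeModel) (hT : 𝔣'.t = 𝔣.t)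
    (hf : ∀ v ∈ D'.cone, AlgPoints.map f (D'.unif v) = D.unif (((g : GL (Fin 3) ℂ) : Matrix (Fin 3) (Fin 3) ℂ) *ᵥ v))
    {hX : IsSmoothProjective 2 X} {c : ℂ ⊗[ℚ] bettiCohomology X 1} (hc : c ∈ (BettiUniverse.hodge hHD hX 1).F 1) :
    D'.classLift hHD 𝔣' ((BettiUniverse.pull f 1).baseChange ℂ c) =
      BallForms.factorPullback BallForms.cotangentCocycle (D.frameIso 𝔣 g) (D.classLift hHD 𝔣 c) := by
  rw [classLift_pull_mulVec D' 𝔣' g hHD hI hT hf hc]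
  funext z
  exact (BallForms.factorPullback_cotangentCocycle_apply _ _ z).symm

end HodgeCM.Model.ClassLiftTwist

end
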